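import Literature.AlgebraicGeometry.AbelianSchemes.AbelianSchemeConstSubgroupQuotient
import HarnessLib

/-!
# Homomorphisms exchange with translations; the invariance hypothesis «`λ(K) ⊆ K′`» of polarisation descent

Layer `Literature/AlgebraicGeometry/AbelianSchemes`, namespace `Literature.AlgebraicGeometry.AbelianSchemes.AbelianSchemeOver`.
THEOREMS ONLY (no definition, no named fact, no instance, no notation, no `sorry`); over ★
`AbelianSchemeConstSubgroupQuotient` (`translation`, `quotientMk`, `translation_comp_quotientMk`).

Setting ([MumfordAV1970] §7 Thm. 4 and §23; [GortzWedhorn2023] Def. 27.1): abelian schemes `A`, `B` over `S`, a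
homomorphism `f : A → B` of `S`-group schemes (`IsMonHom f`), sections `σ ∈ A(S)`.

* §1 **`translation_comp_of_isMonHom`** — `t_σ ≫ f = f ≫ t_{σ ≫ f}`: homomorphisms exchange with translations (on
  `T`-valued points `f(σ · x) = f(σ) · f(x)`; in the tree's currency `t_σ = (A → S →σ A) * 𝟙_A` in the group `Hom_S(A, A)`,
  Mathlib `MonObj.mul_comp` / `MonObj.comp_mul`).
* §2 For a finite subgroup `K′ ⊆ B(S)` with its quotient map `ψ′ : B → B/K′` (★ `quotientMk`):
  **`translation_comp_comp_quotientMk_of_comp_mem`** — if `σ ≫ f ∈ K′` then `t_σ ≫ f ≫ ψ′ = f ≫ ψ′` (§1 + ★ `t_τ ≫ ψ′ = ψ′`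
  for `τ ∈ K′`); **`hlam_of_forall_comp_mem`** — for a subgroup `K ⊆ A(S)` with `f(K) ⊆ K′` (every `σ ∈ K` has
  `σ ≫ f ∈ K′`) the RAW INVARIANCE HYPOTHESIS `hlam : ∀ σ : K, t_σ ≫ f ≫ ψ′ = f ≫ ψ′` of the tree's polarisation descent
  (★ `AbelianSchemeQuotientHomDescent.polarizationDesc`, ★ `HeckeQuotientTriple.exists_quotientTriple_of_fields`, …) holds;
  **`hlam_of_map_le`** / **`hlam_map`** — the same for `K′ ⊇ f_* K`, resp. for `K′ := f_* K` literally
  (`K.map (IsMonHom.monoidHom f (𝟙_ (Over S)))`, Mathlib's «`σ ↦ σ ≫ f`» monoid homomorphism on sections).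

Cell `hodgecm-mathlib` (D-0151), HECKE-LINK socket (B), the `hlam` conjunct of the `hExt` package of ★
`SiegelHeckeQuotientTripleGlue.exists_heckeQuotientTriple_of_ext` (dual-side subgroup `K′ := λ′_* K`).  Count-neutral;
HC_CM is proved only modulo the 7 printed citations until rung 0 closes; nothing here is about HC.

## References
* [MumfordAV1970] D. Mumford, *Abelian Varieties* (1970), §7 Thm. 4 (p. 72), §23 (p. 231).
* [GortzWedhorn2023] U. Görtz, T. Wedhorn, *Algebraic Geometry II* (2023), Def./Rem. 27.1 (p. 604).
-/

noncomputable section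

universe u

open CategoryTheory CategoryTheory.Limits AlgebraicGeometry MonoidalCategory CartesianMonoidalCategory
open scoped MonObj

namespace Literature.AlgebraicGeometry.AbelianSchemes

namespace AbelianSchemeOver

variable {S : Scheme.{u}} (A : AbelianSchemeOver S)

/-! ## §1 Homomorphisms exchange with translations -/

/-- **`t_σ ≫ f = f ≫ t_{σ ≫ f}`**: a homomorphism `f : A → B` of abelian schemes over `S` carries the translation by a
section `σ ∈ A(S)` to the translation by `σ ≫ f ∈ B(S)` (`f(σ · x) = f(σ) · f(x)` on points).
[cite: GortzWedhorn2023, Def./Rem. 27.1 (p. 604)] [cite: MumfordAV1970, §7 Thm. 4 (p. 72)] -/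
theorem translation_comp_of_isMonHom {B : AbelianSchemeOver S} (f : A.X ⟶ B.X) [IsMonHom f] (σ : A.Sections) :
    A.translation σ ≫ f = f ≫ B.translation (σ ≫ f) := by
  have h : f ≫ toUnit B.X ≫ σ ≫ f = toUnit A.X ≫ σ ≫ f := by
    rw [← Category.assoc, toUnit_unique (f ≫ toUnit B.X) (toUnit A.X)]
  unfold translation
  rw [MonObj.mul_comp, Category.id_comp, MonObj.comp_mul, Category.comp_id, Category.assoc, h]

/-- Pointwise form on `T`-valued points: `(x ≫ t_σ) ≫ f = (x ≫ f) ≫ t_{σ ≫ f}`.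
[cite: GortzWedhorn2023, Def./Rem. 27.1 (p. 604)] -/
theorem comp_translation_comp_of_isMonHom {B : AbelianSchemeOver S} (f : A.X ⟶ B.X) [IsMonHom f] {T : Over S}
    (x : T ⟶ A.X) (σ : A.Sections) :
    (x ≫ A.translation σ) ≫ f = (x ≫ f) ≫ B.translation (σ ≫ f) := by
  rw [Category.assoc, A.translation_comp_of_isMonHom f σ, Category.assoc]

/-- The image section spelled through Mathlib's «`σ ↦ σ ≫ f`» monoid homomorphism on sections:
`IsMonHom.monoidHom f 𝟙 σ = σ ≫ f`. [cite: GortzWedhorn2023, Def./Rem. 27.1 (p. 604)] -/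
theorem isMonHom_monoidHom_apply {B : AbelianSchemeOver S} (f : A.X ⟶ B.X) [IsMonHom f] (σ : A.Sections) :
    IsMonHom.monoidHom f (𝟙_ (Over S)) σ = σ ≫ f := rfl

/-! ## §2 The invariance hypothesis «`λ(K) ⊆ K′`» of polarisation descent -/

section Descent

variable {Y : Scheme.{u}} (u : S ⟶ Y) (B : AbelianSchemeOver S) (K' : Subgroup B.Sections) [Finite K']
  [Y.IsSeparated] [IsSeparated (B.X.hom ≫ u)] [S.IsSeparated]
  (hcov' : ∀ x : B.left, ∃ O : (B.translationActionOver u K').StableAffineOpens, x ∈ O.1)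
  (f : A.X ⟶ B.X) [IsMonHom f]

/-- **`σ ≫ f ∈ K′ ⇒ t_σ ≫ f ≫ ψ′ = f ≫ ψ′`** for the quotient map `ψ′ : B → B/K′` (§1 and the `K′`-invariance of `ψ′`,
★ `translation_comp_quotientMk`). [cite: MumfordAV1970, §7 Thm. 4 (p. 72) and §23 (p. 231)] -/
theorem translation_comp_comp_quotientMk_of_comp_mem {σ : A.Sections} (hσ : σ ≫ f ∈ K') :
    A.translation σ ≫ f ≫ B.quotientMk u K' hcov' = f ≫ B.quotientMk u K' hcov' := by
  rw [← Category.assoc, A.translation_comp_of_isMonHom f σ, Category.assoc]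
  exact congrArg (f ≫ ·) (B.translation_comp_quotientMk u K' hcov' ⟨σ ≫ f, hσ⟩)

/-- **The `hlam` hypothesis of polarisation descent from «`f(K) ⊆ K′`»**: if every section of the subgroup `K ⊆ A(S)`
is carried by the homomorphism `f` into `K′ ⊆ B(S)`, then `t_σ ≫ f ≫ ψ′ = f ≫ ψ′` for all `σ ∈ K` — the RAW invariance
hypothesis under which `f ≫ ψ′` descends to `A/K → B/K′` (★ `polarizationDesc`).
[cite: MumfordAV1970, §23 (p. 231) and §7 Thm. 4 (p. 72)] -/
theorem hlam_of_forall_comp_mem (K : Subgroup A.Sections) (h : ∀ σ : K, (σ : A.Sections) ≫ f ∈ K') :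
    ∀ σ : K, A.translation (σ : A.Sections) ≫ f ≫ B.quotientMk u K' hcov' = f ≫ B.quotientMk u K' hcov' :=
  fun σ => A.translation_comp_comp_quotientMk_of_comp_mem u B K' hcov' f (h σ)

/-- The same for any `K′` containing the IMAGE subgroup `f_* K = K.map (σ ↦ σ ≫ f)`.
[cite: MumfordAV1970, §23 (p. 231) and §7 Thm. 4 (p. 72)] -/
theorem hlam_of_map_le (K : Subgroup A.Sections) (hK' : K.map (IsMonHom.monoidHom f (𝟙_ (Over S))) ≤ K') :
    ∀ σ : K, A.translation (σ : A.Sections) ≫ f ≫ B.quotientMk u K' hcov' = f ≫ B.quotientMk u K' hcov' :=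
  A.hlam_of_forall_comp_mem u B K' hcov' f K fun σ => hK' (Subgroup.mem_map_of_mem _ σ.2)

end Descent

/-- **`hlam` for the image subgroup `K′ := f_* K` itself** (`K.map (σ ↦ σ ≫ f)`; finite as the image of the finite
`K`): `t_σ ≫ f ≫ ψ′ = f ≫ ψ′` for all `σ ∈ K`. [cite: MumfordAV1970, §23 (p. 231) and §7 Thm. 4 (p. 72)] -/
theorem hlam_map {Y : Scheme.{u}} (u : S ⟶ Y) (B : AbelianSchemeOver S) (f : A.X ⟶ B.X) [IsMonHom f]
    (K : Subgroup A.Sections) [Finite (K.map (IsMonHom.monoidHom f (𝟙_ (Over S))))]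
    [Y.IsSeparated] [IsSeparated (B.X.hom ≫ u)] [S.IsSeparated]
    (hcov' : ∀ x : B.left,
      ∃ O : (B.translationActionOver u (K.map (IsMonHom.monoidHom f (𝟙_ (Over S))))).StableAffineOpens, x ∈ O.1) :
    ∀ σ : K, A.translation (σ : A.Sections) ≫ f ≫
        B.quotientMk u (K.map (IsMonHom.monoidHom f (𝟙_ (Over S)))) hcov' =
      f ≫ B.quotientMk u (K.map (IsMonHom.monoidHom f (𝟙_ (Over S)))) hcov' :=
  A.hlam_of_map_le u B _ hcov' f K le_rfl

/-- The image subgroup of a finite subgroup of sections is finite (so that `K′ := f_* K` meets the `[Finite K′]` binder of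
★ `quotientMk`). [cite: MumfordAV1970, §7 Thm. 4 (p. 72)] -/
theorem finite_map_isMonHom_monoidHom {B : AbelianSchemeOver S} (f : A.X ⟶ B.X) [IsMonHom f]
    (K : Subgroup A.Sections) [Finite K] : Finite (K.map (IsMonHom.monoidHom f (𝟙_ (Over S)))) :=
  Finite.of_surjective
    (fun σ : K => (⟨IsMonHom.monoidHom f (𝟙_ (Over S)) σ, Subgroup.mem_map_of_mem _ σ.2⟩ :
      K.map (IsMonHom.monoidHom f (𝟙_ (Over S)))))
    fun τ => by
      obtain ⟨σ, hσ, hστ⟩ := Subgroup.mem_map.1 τ.2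
      exact ⟨⟨σ, hσ⟩, Subtype.ext hστ⟩

end AbelianSchemeOver

end Literature.AlgebraicGeometry.AbelianSchemes

end
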